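import Literature.MathematicalPhysics.QuantumFieldTheory.Balaban1983to89.T3DescentFibreTower
import Literature.MathematicalPhysics.QuantumFieldTheory.Balaban1983to89.T3CruxEstimates
import HarnessLib

/-!
# `FluctuationComparisonRegPrIntLSupTailDepthInduction` — LINE g21-1 «SUP-TAIL × CRUDE LOCALITY»: TAILSUP AT EVERY DEPTH ⟸ ONE-LEVEL WINDOW ODDS AT EVERY LEVEL
# (the measure-currency depth induction behind COND-ODDS; crux `UnitScaleTilt.FluctuationComparisonRegPrIntL`, stmt-QuantumFields-20520; row TAILSUP
# `WindowOddsSupCan` of `Cruxes/…/Lines/suptail_split.lean`, ideator ym-r3-idea-1 g21; companion of ✓`…SupTailReduction` (A) whose hypothesis COND-ODDS this file produces)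

Cell `ym3-torus` (YM ladder rung R3 = continuum SU(2) Yang–Mills on T³ — a RUNG, NOT the Clay problem: not d = 4, not infinite volume, not a mass gap);
width seat `ym-ust-20520-w3` (gen 17); helper `--supports stmt-QuantumFields-20520`.  THEOREMS ONLY (0 `def`, 0 `sorry`, default heartbeats).

WHY.  ✓A reduces TAILSUP (all depths `K − J`) to COND-ODDS: `Gibbs_K(D_{J,K}⁻¹B) ≤ e^{τ_J}·Gibbs_K(D_{J,K}⁻¹B ∩ histGood K J)` for measurable `B` inside the height-`J`
window.  The good history `histGood K J` is the intersection over the levels `j = J+1, …, K` of «the level-`j` field `D_{j,K}U` lies in its window `W_j`»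
(`mem_histGood_iff_descendTo`, §1), so COND-ODDS follows by a DEPTH INDUCTION from a ONE-LEVEL statement at every level `i ∈ [J, K)` of the SAME run `K`:
  ONE-LEVEL(i, K)  `∀ B ⊆ W_i measurable, Gibbs_K(D_{i,K}⁻¹B) ≤ e^{t_i}·Gibbs_K(D_{i,K}⁻¹B ∩ D_{i+1,K}⁻¹W_{i+1})`
(«given the level-`i` window σ-algebra, the NEXT finer level is in its window with odds `≥ e^{−t_i}`»), with `τ_J = Σ_{J ≤ i < K} t_i` — the measure-currency twin
of the odds ledger's per-scale increments (LINE g20-2), with no version, no density and no pinning.  The induction step re-bases the running event on the level-`i`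
tower by the tower identity ✓`descendTo_descendTo` (`D_{j,K} = D_{j,i} ∘ D_{i,K}`), so that it is again of the form `D_{i,K}⁻¹(B_i)` with `B_i ⊆ W_i`.
* §1 `plaqSmall_descendTo_iff`, ★`mem_histGood_iff_descendTo` (Bałaban's event as the intersection of the level windows along `descendTo`).
* §2 ★★★`condGoodOdds_of_oneLevel` — ONE-LEVEL at every `i ∈ [J, K)` ⇒ `Gibbs_K(D_{J,K}⁻¹B) ≤ ofReal(exp(Σ_{i ∈ [J,K)} t i))·Gibbs_K(D_{J,K}⁻¹B ∩ histGood K J)` for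
  every measurable `B ⊆ W_J`; ★`condGoodOdds_of_oneLevel_of_sum_le` — the same with any `τ ≥ Σ_{i∈[J,K)} t i` (e.g. a `K`-uniform tail sum), i.e. COND-ODDS's
  inequality at `(J, K)` as ✓A's `window_logOdds_bounds` ∕ `windowOddsSupCan_of_condGoodOdds` consume it.
HONEST SCOPE.  Set algebra + induction; ONE-LEVEL (a conditional large-deviation bound for the level-`(i+1)` field of run `K` given the level-`i` window datum, with the
finer levels integrated freely) is the HYPOTHESIS and is NOT proved; TAILSUP, LFR♯ᶜ, S2β, 20520, `YM3TorusSU2` NOT proved; the Yang–Mills mass gap is NOT proved.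
References: [Balaban1985UV3] (7) p. 257 (the decomposition of unity over the levels), (38)–(40) p. 266; [Balaban1987RG1] (0.11) p. 253 (one averaging formula at every level).
-/

noncomputable section

set_option autoImplicit false

open MeasureTheory Filter Topology Set
open scoped ENNReal NNReal BigOperators
open Literature.MathematicalPhysics.QuantumFieldTheory.Balaban1983to89
open Literature.MathematicalPhysics.QuantumFieldTheory.Balaban1983to89.T3ContinuumYM3Torus
open Literature.MathematicalPhysics.QuantumFieldTheory.Balaban1983to89.T3NestedUnitLaws
open Literature.MathematicalPhysics.QuantumFieldTheory.Balaban1983to89.T3UnitLawDensityEML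
open Literature.MathematicalPhysics.QuantumFieldTheory.Balaban1983to89.T3UnitScaleTilt
open Literature.MathematicalPhysics.QuantumFieldTheory.Balaban1983to89.T3TiltDescent
open Literature.MathematicalPhysics.QuantumFieldTheory.Balaban1983to89.T3DescentFibreTower
open Literature.MathematicalPhysics.QuantumFieldTheory.Balaban1983to89.T3CruxEstimates (plaqSmall_fieldShift)
open Literature.MathematicalPhysics.QuantumFieldTheory.Balaban1983to89.Missing

namespace Summit.QuantumFields.YangMills.Theorems.FluctuationComparisonRegPrIntLSupTailDepthInduction

variable (F : T3Family)

/-! ## §1 Bałaban's UV-small-history event as the intersection of the level windows along `descendTo` -/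

/-- The level-`j` window read through `D_{j,K}` is the window of the `(K − j)`-fold averaged field (`descendTo` = `fieldShift ∘ iter`, and `PlaqSmall` is
`fieldShift`-invariant, ✓`plaqSmall_fieldShift`). [cite: Balaban1987RG1, (0.11) p.253] -/
theorem plaqSmall_descendTo_iff {j K : ℕ} (h : j ≤ K) (δ : ℝ) (U : GaugeField (F.P K) 0 (Matrix.specialUnitaryGroup (Fin 2) ℂ)) :
    PlaqSmall δ (descendTo F ℰp j K h U) ↔
      PlaqSmall δ (Averaging.iter (fun i => BlockAveraging.blockAvg (P := F.P K) (j := i) ℰp) (K - j) U) :=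
  plaqSmall_fieldShift F _ δ _

/-- ★ **`histGood K n` = «every level `j ∈ [n, K]` of the run lies in its window, read through `descendTo`»**. [cite: Balaban1985UV3, (7) p.257] -/
theorem mem_histGood_iff_descendTo (θ : ℕ → ℝ) {K n : ℕ} (U : GaugeField (F.P K) 0 (Matrix.specialUnitaryGroup (Fin 2) ℂ)) :
    U ∈ histGood F ℰp θ K n ↔ ∀ j, n ≤ j → ∀ hjK : j ≤ K, PlaqSmall (θ j) (descendTo F ℰp j K hjK U) := by
  simp only [histGood, Set.mem_setOf_eq]
  constructor
  · intro h j hnj hjK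
    rw [plaqSmall_descendTo_iff]
    have h1 := h (K - j) (by omega)
    rwa [show K - (K - j) = j by omega] at h1
  · intro h i hi
    have h1 := h (K - i) (by omega) (by omega)
    rw [plaqSmall_descendTo_iff, show K - (K - i) = i by omega] at h1
    exact h1

/-! ## §2 The depth induction: ONE-LEVEL window odds at every level ⇒ COND-ODDS at every depth -/

section Induction

variable {γ : ℝ} (θ : ℕ → ℝ) (K : ℕ)

/-- The running event of the induction: the fine fields whose level-`J` datum lies in `B` and whose levels `J < j ≤ J + k` lie in their windows
(local abbreviation-free helper: stated inline). Its `k = 0` instance is `D_{J,K}⁻¹B`. [cite: Balaban1985UV3, (7) p.257] -/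
theorem runningEvent_zero {J : ℕ} (hJK : J ≤ K) (B : Set (GaugeField (F.P J) 0 (Matrix.specialUnitaryGroup (Fin 2) ℂ))) :
    {U : GaugeField (F.P K) 0 (Matrix.specialUnitaryGroup (Fin 2) ℂ) | descendTo F ℰp J K hJK U ∈ B ∧
        ∀ j, J < j → j ≤ J + 0 → ∀ hjK : j ≤ K, PlaqSmall (θ j) (descendTo F ℰp j K hjK U)} = descendTo F ℰp J K hJK ⁻¹' B := by
  ext U
  simp only [Set.mem_setOf_eq, Set.mem_preimage, add_zero]
  constructor
  · exact fun h => h.1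
  · exact fun h => ⟨h, fun j hj hj' _ => absurd (lt_of_lt_of_le hj hj') (lt_irrefl _)⟩

/-- At full depth the running event is `D_{J,K}⁻¹B ∩ histGood K J` (for `B` inside the level-`J` window, which supplies the level `j = J`). [cite: Balaban1985UV3, (7) p.257] -/
theorem runningEvent_full {J : ℕ} (hJK : J ≤ K) {B : Set (GaugeField (F.P J) 0 (Matrix.specialUnitaryGroup (Fin 2) ℂ))}
    (hBW : B ⊆ {V | PlaqSmall (θ J) V}) :
    {U : GaugeField (F.P K) 0 (Matrix.specialUnitaryGroup (Fin 2) ℂ) | descendTo F ℰp J K hJK U ∈ B ∧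
        ∀ j, J < j → j ≤ J + (K - J) → ∀ hjK : j ≤ K, PlaqSmall (θ j) (descendTo F ℰp j K hjK U)} =
      descendTo F ℰp J K hJK ⁻¹' B ∩ histGood F ℰp θ K J := by
  ext U
  simp only [Set.mem_setOf_eq, Set.mem_inter_iff, Set.mem_preimage, mem_histGood_iff_descendTo]
  constructor
  · rintro ⟨hB, h⟩
    refine ⟨hB, fun j hJj hjK => ?_⟩
    rcases (Nat.eq_or_lt_of_le hJj) with hEq | hlt
    · subst hEq
      exact hBW hB
    · exact h j hlt (by omega) hjK
  · rintro ⟨hB, h⟩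
    exact ⟨hB, fun j hJj _ hjK => h j hJj.le hjK⟩

/-- **THE INDUCTION STEP's RE-BASING**: the running event at depth `k` (`J + k ≤ K`) is the `D_{J+k,K}`-preimage of a measurable subset of the level-`(J+k)` window —
namely the level-`(J+k)` fields whose own descents to the levels `J, …, J+k` satisfy the constraints (tower identity ✓`descendTo_descendTo`). [cite: Balaban1987RG1, (0.11) p.253] -/
theorem runningEvent_eq_preimage {J k : ℕ} (hk : J + k ≤ K) (hJK : J ≤ K) (B : Set (GaugeField (F.P J) 0 (Matrix.specialUnitaryGroup (Fin 2) ℂ))) :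
    {U : GaugeField (F.P K) 0 (Matrix.specialUnitaryGroup (Fin 2) ℂ) | descendTo F ℰp J K hJK U ∈ B ∧
        ∀ j, J < j → j ≤ J + k → ∀ hjK : j ≤ K, PlaqSmall (θ j) (descendTo F ℰp j K hjK U)} =
      descendTo F ℰp (J + k) K hk ⁻¹'
        {V : GaugeField (F.P (J + k)) 0 (Matrix.specialUnitaryGroup (Fin 2) ℂ) |
          descendTo F ℰp J (J + k) (Nat.le_add_right J k) V ∈ B ∧
          ∀ j, J < j → ∀ hj : j ≤ J + k, PlaqSmall (θ j) (descendTo F ℰp j (J + k) hj V)} := by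
  ext U
  simp only [Set.mem_setOf_eq, Set.mem_preimage]
  rw [descendTo_descendTo F ℰp (Nat.le_add_right J k) hk U]
  constructor
  · rintro ⟨hB, h⟩
    refine ⟨hB, fun j hJj hj => ?_⟩
    rw [descendTo_descendTo F ℰp hj hk U]
    exact h j hJj hj (hj.trans hk)
  · rintro ⟨hB, h⟩
    refine ⟨hB, fun j hJj hj hjK => ?_⟩
    rw [← descendTo_descendTo F ℰp hj hk U]
    exact h j hJj hj

/-- ★★★ **COND-ODDS AT EVERY DEPTH ⟸ ONE-LEVEL WINDOW ODDS AT EVERY LEVEL** (`γ` arbitrary; thresholds `θ : ℕ → ℝ` arbitrary, e.g. `θBal F.L γ b₀ p₀`): if for every level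
`i` with `J ≤ i < K` and every measurable `B′` inside the level-`i` window `{PlaqSmall (θ i)}` the run-`K` Gibbs measure satisfies
`Gibbs_K(D_{i,K}⁻¹B′) ≤ ofReal(e^{t i})·Gibbs_K(D_{i,K}⁻¹B′ ∩ D_{i+1,K}⁻¹{PlaqSmall (θ (i+1))})`, then for every measurable `B` inside the level-`J` window
`Gibbs_K(D_{J,K}⁻¹B) ≤ ofReal(exp(Σ_{i ∈ [J,K)} t i))·Gibbs_K(D_{J,K}⁻¹B ∩ histGood K J)`. [cite: Balaban1985UV3, (7) p.257 and (38)-(40) p.266] -/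
theorem condGoodOdds_of_oneLevel {J : ℕ} (hJK : J ≤ K) (t : ℕ → ℝ)
    (hone : ∀ (i : ℕ) (hJi : J ≤ i) (hiK : i < K) (B' : Set (GaugeField (F.P i) 0 (Matrix.specialUnitaryGroup (Fin 2) ℂ))),
      MeasurableSet B' → B' ⊆ {V | PlaqSmall (θ i) V} →
        gibbsK F ℰp γ K (descendTo F ℰp i K hiK.le ⁻¹' B') ≤
          ENNReal.ofReal (Real.exp (t i)) *
            gibbsK F ℰp γ K (descendTo F ℰp i K hiK.le ⁻¹' B' ∩
              descendTo F ℰp (i + 1) K (Nat.succ_le_of_lt hiK) ⁻¹' {V | PlaqSmall (θ (i + 1)) V}))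
    {B : Set (GaugeField (F.P J) 0 (Matrix.specialUnitaryGroup (Fin 2) ℂ))} (hB : MeasurableSet B) (hBW : B ⊆ {V | PlaqSmall (θ J) V}) :
    gibbsK F ℰp γ K (descendTo F ℰp J K hJK ⁻¹' B) ≤
      ENNReal.ofReal (Real.exp (∑ i ∈ Finset.Ico J K, t i)) * gibbsK F ℰp γ K (descendTo F ℰp J K hJK ⁻¹' B ∩ histGood F ℰp θ K J) := by
  -- induction on the depth `k ≤ K − J` of the running event
  have key : ∀ k : ℕ, ∀ hk : J + k ≤ K,
      gibbsK F ℰp γ K (descendTo F ℰp J K hJK ⁻¹' B) ≤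
        ENNReal.ofReal (Real.exp (∑ i ∈ Finset.Ico J (J + k), t i)) *
          gibbsK F ℰp γ K {U | descendTo F ℰp J K hJK U ∈ B ∧
            ∀ j, J < j → j ≤ J + k → ∀ hjK : j ≤ K, PlaqSmall (θ j) (descendTo F ℰp j K hjK U)} := by
    intro k
    induction k with
    | zero =>
      intro hk
      rw [runningEvent_zero F θ K hJK B]
      simp
    | succ k ih =>
      intro hk
      have hk' : J + k ≤ K := by omega
      have hlt : J + k < K := by omega
      -- re-base the running event at depth `k` on the level-`(J+k)` tower
      set B' : Set (GaugeField (F.P (J + k)) 0 (Matrix.specialUnitaryGroup (Fin 2) ℂ)) :=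
        {V | descendTo F ℰp J (J + k) (Nat.le_add_right J k) V ∈ B ∧
          ∀ j, J < j → ∀ hj : j ≤ J + k, PlaqSmall (θ j) (descendTo F ℰp j (J + k) hj V)} with hB'
      have hB'm : MeasurableSet B' := by
        have h1 : MeasurableSet {V : GaugeField (F.P (J + k)) 0 (Matrix.specialUnitaryGroup (Fin 2) ℂ) |
            descendTo F ℰp J (J + k) (Nat.le_add_right J k) V ∈ B} :=
          measurable_descendTo F ℰp measurableE_ℰp _ hB
        have h2 : MeasurableSet {V : GaugeField (F.P (J + k)) 0 (Matrix.specialUnitaryGroup (Fin 2) ℂ) |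
            ∀ j, J < j → ∀ hj : j ≤ J + k, PlaqSmall (θ j) (descendTo F ℰp j (J + k) hj V)} := by
          have hset : {V : GaugeField (F.P (J + k)) 0 (Matrix.specialUnitaryGroup (Fin 2) ℂ) |
              ∀ j, J < j → ∀ hj : j ≤ J + k, PlaqSmall (θ j) (descendTo F ℰp j (J + k) hj V)} =
              ⋂ j ∈ Finset.Ioc J (J + k), {V | ∀ hj : j ≤ J + k, PlaqSmall (θ j) (descendTo F ℰp j (J + k) hj V)} := by
            ext V
            simp only [Set.mem_setOf_eq, Set.mem_iInter, Finset.mem_Ioc, and_imp]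
            exact ⟨fun h i hJi _ hj => h i hJi hj, fun h j hJj hj => h j hJj hj hj⟩
          rw [hset]
          refine MeasurableSet.biInter (Finset.countable_toSet _) fun j hj => ?_
          have hj' : j ≤ J + k := (Finset.mem_Ioc.mp hj).2
          have : {V : GaugeField (F.P (J + k)) 0 (Matrix.specialUnitaryGroup (Fin 2) ℂ) |
              ∀ hj : j ≤ J + k, PlaqSmall (θ j) (descendTo F ℰp j (J + k) hj V)} =
              descendTo F ℰp j (J + k) hj' ⁻¹' {V | PlaqSmall (θ j) V} := by
            ext V
            simp only [Set.mem_setOf_eq, Set.mem_preimage]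
            exact ⟨fun h => h hj', fun h _ => h⟩
          rw [this]
          exact measurable_descendTo F ℰp measurableE_ℰp _ (measurableSet_plaqSmall _)
        simpa only [hB', Set.setOf_and] using h1.inter h2
      have hB'W : B' ⊆ {V | PlaqSmall (θ (J + k)) V} := by
        intro V hV
        cases k with
        | zero =>
          have e : descendTo F ℰp J (J + 0) (Nat.le_add_right J 0) V = V := descendTo_self F ℰp J V
          have hVB : V ∈ B := by
            have h0 := hV.1
            rwa [e] at h0
          exact hBW hVB
        | succ k' =>
          have h2 := hV.2 (J + (k' + 1)) (by omega) le_rfl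
          rwa [descendTo_self] at h2
      -- ONE-LEVEL at `i = J + k`
      have hstep := hone (J + k) (Nat.le_add_right J k) hlt B' hB'm hB'W
      -- the two events of `hstep` are the running events at depths `k` and `k+1`
      have hEk := runningEvent_eq_preimage F θ K hk' hJK B
      have hEk1 : descendTo F ℰp (J + k) K hk' ⁻¹' B' ∩
            descendTo F ℰp (J + k + 1) K (Nat.succ_le_of_lt hlt) ⁻¹' {V | PlaqSmall (θ (J + k + 1)) V} =
          {U | descendTo F ℰp J K hJK U ∈ B ∧
            ∀ j, J < j → j ≤ J + (k + 1) → ∀ hjK : j ≤ K, PlaqSmall (θ j) (descendTo F ℰp j K hjK U)} := by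
        rw [← hEk]
        ext U
        simp only [Set.mem_inter_iff, Set.mem_setOf_eq, Set.mem_preimage]
        constructor
        · rintro ⟨⟨hB0, h⟩, hnew⟩
          refine ⟨hB0, fun j hJj hj hjK => ?_⟩
          rcases Nat.eq_or_lt_of_le hj with hEq | hlt'
          · subst hEq
            exact hnew
          · exact h j hJj (by omega) hjK
        · rintro ⟨hB0, h⟩
          exact ⟨⟨hB0, fun j hJj hj hjK => h j hJj (by omega) hjK⟩, h (J + k + 1) (by omega) (by omega) _⟩
      calc gibbsK F ℰp γ K (descendTo F ℰp J K hJK ⁻¹' B)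
          ≤ ENNReal.ofReal (Real.exp (∑ i ∈ Finset.Ico J (J + k), t i)) *
              gibbsK F ℰp γ K {U | descendTo F ℰp J K hJK U ∈ B ∧
                ∀ j, J < j → j ≤ J + k → ∀ hjK : j ≤ K, PlaqSmall (θ j) (descendTo F ℰp j K hjK U)} := ih hk'
        _ ≤ ENNReal.ofReal (Real.exp (∑ i ∈ Finset.Ico J (J + k), t i)) *
              (ENNReal.ofReal (Real.exp (t (J + k))) *
                gibbsK F ℰp γ K {U | descendTo F ℰp J K hJK U ∈ B ∧
                  ∀ j, J < j → j ≤ J + (k + 1) → ∀ hjK : j ≤ K, PlaqSmall (θ j) (descendTo F ℰp j K hjK U)}) := by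
            refine mul_le_mul' le_rfl ?_
            rw [hEk, ← hEk1]
            exact hstep
        _ = ENNReal.ofReal (Real.exp (∑ i ∈ Finset.Ico J (J + (k + 1)), t i)) *
              gibbsK F ℰp γ K {U | descendTo F ℰp J K hJK U ∈ B ∧
                ∀ j, J < j → j ≤ J + (k + 1) → ∀ hjK : j ≤ K, PlaqSmall (θ j) (descendTo F ℰp j K hjK U)} := by
            rw [← mul_assoc, ← ENNReal.ofReal_mul (Real.exp_pos _).le, ← Real.exp_add,
              show J + (k + 1) = J + k + 1 by omega, Finset.sum_Ico_succ_top (by omega : J ≤ J + k)]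
  have h := key (K - J) (by omega)
  rwa [runningEvent_full F θ K hJK hBW, show J + (K - J) = K by omega] at h

/-- ★ **WITH ANY MAJORANT OF THE LEVEL SUM** (e.g. a `K`-uniform tail `τ J ≥ Σ_{i ≥ J} t i` of a summable `t ≥ 0`): ONE-LEVEL at every level ⇒
`Gibbs_K(D_{J,K}⁻¹B) ≤ ofReal(e^{τ})·Gibbs_K(D_{J,K}⁻¹B ∩ histGood K J)` — COND-ODDS's inequality at `(J, K)` in the shape ✓A's `window_logOdds_bounds` consumes.
[cite: Balaban1985UV3, (7) p.257 and (38)-(40) p.266] -/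
theorem condGoodOdds_of_oneLevel_of_sum_le {J : ℕ} (hJK : J ≤ K) (t : ℕ → ℝ) {τ : ℝ} (hτ : ∑ i ∈ Finset.Ico J K, t i ≤ τ)
    (hone : ∀ (i : ℕ) (hJi : J ≤ i) (hiK : i < K) (B' : Set (GaugeField (F.P i) 0 (Matrix.specialUnitaryGroup (Fin 2) ℂ))),
      MeasurableSet B' → B' ⊆ {V | PlaqSmall (θ i) V} →
        gibbsK F ℰp γ K (descendTo F ℰp i K hiK.le ⁻¹' B') ≤
          ENNReal.ofReal (Real.exp (t i)) *
            gibbsK F ℰp γ K (descendTo F ℰp i K hiK.le ⁻¹' B' ∩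
              descendTo F ℰp (i + 1) K (Nat.succ_le_of_lt hiK) ⁻¹' {V | PlaqSmall (θ (i + 1)) V}))
    {B : Set (GaugeField (F.P J) 0 (Matrix.specialUnitaryGroup (Fin 2) ℂ))} (hB : MeasurableSet B) (hBW : B ⊆ {V | PlaqSmall (θ J) V}) :
    gibbsK F ℰp γ K (descendTo F ℰp J K hJK ⁻¹' B) ≤
      ENNReal.ofReal (Real.exp τ) * gibbsK F ℰp γ K (descendTo F ℰp J K hJK ⁻¹' B ∩ histGood F ℰp θ K J) :=
  (condGoodOdds_of_oneLevel F θ K hJK t hone hB hBW).trans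
    (mul_le_mul' (ENNReal.ofReal_le_ofReal (Real.exp_le_exp.mpr hτ)) le_rfl)

end Induction

end Summit.QuantumFields.YangMills.Theorems.FluctuationComparisonRegPrIntLSupTailDepthInduction

end
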